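import Summits.ResolutionOfSingularities.ResolutionOfSingularities.Theorems.CurveBranchPort
import HarnessLib

/-!
# CurveBranchRoot — «CurveBranchLaw» FILE C (decomp-res lens-4, g44): THE (R1) RE-LETTERING AT WEIGHT 0 (§160) AND THE ROOT WITH 14
# BINDERS, POSITION 2 RE-TYPED `hC : MaxContactCut.CurveLawAll ↦ hF : HuggedBranchResolution` (§161)

Third slice of the g44 node «CurveBranchLaw» (node header: `Theorems/CurveBranchKernel.lean`; port: `Theorems/CurveBranchPort.lean`).
§160 (window (R1), REQUIRED AT WEIGHT 0, no credit): inside the mixed residual every marked local ring has dimension `≥ 3`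
(`three_le_ringKrullDim_of_surfaceHugging`) and the ring dimension is constant along a forced tower (`tower_ringKrullDim_pt_eq`, BY NAME), so
«not a threefold tower» ⟺ «fourfold tower» (`fourfoldTower_iff_not_threefold`); the g43 located residual is re-lettered EXACTLY,
`noWildOccultNonThreefoldMixedTowers_iff_g44 : NoWildOccultNonThreefoldMixedTowers ↔ NoWildOccultFourfoldMixedTowers` — a cut «by
dimension behaviour» is therefore EMPTY BY LETTERS (every sub-cell is the whole residual or empty); the root binders `hC4` / `hD4` are NOT
re-typed.  BARRIER (honest tag on the fourfold cells): non-existence of infinite forced towers at closed points of REGULAR FOUR-DIMENSIONAL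
local rings in characteristic `p ∣ n` has no theorem in print (dimension ≤ 3: Cossart–Piltant 2019 Thm. 1.1; dimension ≤ 2 excellent:
CJS2020); inhabited at every finite level.
§161: the root consumers `ftt_step_of_g44`, `forcedTowersTerminate_of_g44`, `noForcedTowers_of_g44 : … → MaxContactCut.NoForcedTowers` =
g43's (`Theorems/PolygonLawRoot` :146) with EXACTLY the binder `hC : MaxContactCut.CurveLawAll` (position 2) RE-TYPED as
`hF : HuggedBranchResolution` and the other 13 VERBATIM — 14 binders hMo hF hSL hH hP hM hRi h71 hB hC4 hD4 hNP hPu hR, all still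
HYPOTHESES; `_residual` twin (13 binders, `hres : NoWildOccultNonThreefoldMixedTowers`); `_carve` twin (position 2 =
`hS : SingularBranchCurveLawAll`, the located residual cell, via `curveLawAll_iff_g44`).
AI-written; AI review weaker than expert review.  `MaxContactCut.NoForcedTowers` (30253) is NOT proved; `MaxContactCut.CurveLawAll`
(32207) is NOT proved — it is RE-TYPED em-exactly onto its located residual `HuggedBranchResolution` (KNOWN IN PRINT · UNDECIDED IN THE
TREE; discharging it from the Literature δ-engine is the announced g45 stage, not claimed here).  No named facts, no ports, no sorry.
-/

noncomputable section

set_option linter.dupNamespace false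

open CategoryTheory CategoryTheory.Limits AlgebraicGeometry TopologicalSpace IsLocalRing
open Literature.AlgebraicGeometry.Resolution Scheme.IdealSheafData
open Summit.ResolutionOfSingularities.ResolutionOfSingularities.Theorems
open WeakOrderReduction ForcedTowerClasses DivergentTowerClasses MonomialTowerClasses
open HugDimensionClasses HugDimensionKernels SurfaceShadowClasses SurfaceShadowKernels AbsoluteContactClasses

namespace Summit.ResolutionOfSingularities.ResolutionOfSingularities.Theorems.HugValuationCut

universe u

variable {k : Type} [Field k]

/-! ## ══ FILE C `Theorems/CurveBranchRoot.lean` (§160–§161; imports FILE B; opens `…Theses` inside its sections) ══ -/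

/-! ## §160 (g44 · WINDOW (R1) AT WEIGHT 0, REQUIRED) «cut by ring-dimension behaviour along the tower» IS EMPTY BY LETTERS: inside
the mixed residual (⊆ `SingularClass` ⊆ surface hugging) every marked local ring has dimension `≥ 3`, the ring dimension is CONSTANT along a
forced tower (`tower_ringKrullDim_pt_eq`, Theorems/RestrictCutPort :155, BY NAME), so «not a threefold tower» ⟺ «fourfold at EVERY stage»
⟺ «fourfold at the root»; the only exact re-location is the re-lettering `…NonThreefold… ↔ …Fourfold…` below (0-weight; `hC4` / `hD4` are
NOT re-typed in the root).  BARRIER (honest tag): the fourfold cells ask for the non-existence of infinite forced towers at closed points of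
REGULAR FOUR-DIMENSIONAL local rings in characteristic `p ∣ n` — embedded resolution / local uniformization in dimension 4 and positive
characteristic has NO THEOREM IN PRINT (dimension ≤ 3: [cite: CossartPiltant2019, Thm. 1.1]; surfaces / dimension ≤ 2 excellent:
[cite: CossartJannsenSaito2020, Thm. 1.1]); every finite level of these cells is inhabited (NOTICE-CurveBranchLaw.md §4). -/

section DimensionCut

open Summit.ResolutionOfSingularities.ResolutionOfSingularities.Theses

/-- **FOURFOLD TOWER**: ring dimension `≥ 4` at EVERY marked point (under `IsBase`, `dim ≤ 4`: exactly 4). -/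
def FourfoldTower (T : ForcedTower) : Prop := ∀ i, DimFourAt T i

/-- surface hugging forces ring dimension `≥ 3` at every marked point of a forced tower of weight `n ≥ 1` (the hugged stalk is a non-zero
ideal with two-dimensional quotient; constancy of the ring dimension). [folklore] -/
theorem three_le_ringKrullDim_of_surfaceHugging (T : ForcedTower) (g : T.St 0 ⟶ Spec (.of k)) (hB : IsBase (T.St 0) g) {n : ℕ}
    (hD : IsDatum n (T.D 0)) (hn : 1 ≤ n) (h : SurfaceHugging T) (i : ℕ) : DimThreeAt T i := by
  obtain ⟨m, H, hH, hdim⟩ := h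
  haveI := (tower_isLocallyNoetherian_isRegular T g hB m).1
  haveI : IsRegularLocalRing ((T.St m).presheaf.stalk (T.pt m)) := (tower_isBase T g hB m).isRegular _
  haveI : IsDomain ((T.St m).presheaf.stalk (T.pt m)) := isDomain_of_isRegularLocalRing _
  have hne : stalkIdeal H (T.pt m) ≠ ⊥ := fun h0 => hH.1 (idealOrder_eq_top_of_stalkIdeal_eq_bot' _ _ h0)
  obtain ⟨r, hrJ, hr0⟩ := Submodule.exists_mem_ne_zero_of_ne_bot hne
  have h1 := ringKrullDim_succ_le_of_surjective (Ideal.Quotient.mk (stalkIdeal H (T.pt m))) Ideal.Quotient.mk_surjective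
    (mem_nonZeroDivisors_of_ne_zero hr0) (Ideal.Quotient.eq_zero_iff_mem.mpr hrJ)
  rw [hdim] at h1
  unfold DimThreeAt
  rw [tower_ringKrullDim_pt_eq T g hB hD hn i, ← tower_ringKrullDim_pt_eq T g hB hD hn m]
  exact le_trans (by decide) h1

/-- inside the surface-hugging class, «NOT a threefold tower» ⟺ «FOURFOLD tower» (weight `n ≥ 1`; constancy of the ring dimension
`tower_ringKrullDim_pt_eq` BY NAME). [folklore] -/
theorem fourfoldTower_iff_not_threefold (T : ForcedTower) (g : T.St 0 ⟶ Spec (.of k)) (hB : IsBase (T.St 0) g) {n : ℕ}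
    (hD : IsDatum n (T.D 0)) (hn : 1 ≤ n) (h : SurfaceHugging T) : FourfoldTower T ↔ ¬ ThreefoldTower T := by
  have h3 := three_le_ringKrullDim_of_surfaceHugging T g hB hD hn h
  have hconst : ∀ i, DimFourAt T i ↔ DimFourAt T 0 := fun i => by
    unfold DimFourAt; rw [tower_ringKrullDim_pt_eq T g hB hD hn i]
  constructor
  · intro h4 ht
    exact (ht 0).2 (h4 0)
  · intro hnt i
    by_contra h4
    exact hnt fun j => ⟨h3 j, fun h4j => h4 ((hconst i).mpr ((hconst j).mp h4j))⟩

/-- the mixed residual is surface hugging (its first letter is `SingularClass`). [folklore] -/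
theorem surfaceHugging_of_mixedResidual {n : ℕ} {T : ForcedTower} (h : MixedResidual n T) : SurfaceHugging T :=
  h.1.1.1.1.1.1.1.1.1.1.1.2.2.1

/-- CELL C₄′ (re-lettering of CELL C₄ «occult divisorial NON-THREEFOLD», Theorems/CurveCutCells :78, with `¬ ThreefoldTower T` ↦
`FourfoldTower T`) · UNDECIDED · BARRIER: regular four-dimensional marked local rings in characteristic `p ∣ n` — no theorem in print
(dimension ≤ 3 only: CossartPiltant2019 Thm. 1.1; CJS2020 for surfaces); INHABITED AT EVERY FINITE LEVEL. -/
def WildOccultDivisorialFourfoldMixedWallFreeFreshJumpShallowCompanionKangarooTowersTerminate (n : ℕ) : Prop :=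
  NoTowerWild n fun T => (((MixedResidual n T ∧ ¬ (LatentFactorTower T ∧ ThreefoldTower T)) ∧ ¬ LatentFactorTower T) ∧
    DivisorialTower T) ∧ FourfoldTower T

/-- CELL D₄′ (re-lettering of CELL D₄ «occult non-divisorial NON-THREEFOLD», Theorems/RestrictCutCells :82, with `¬ ThreefoldTower T` ↦
`FourfoldTower T`) · UNDECIDED · BARRIER as for C₄′. -/
def WildOccultNonDivisorialFourfoldMixedWallFreeFreshJumpShallowCompanionKangarooTowersTerminate (n : ℕ) : Prop :=
  NoTowerWild n fun T => (((MixedResidual n T ∧ ¬ (LatentFactorTower T ∧ ThreefoldTower T)) ∧ ¬ LatentFactorTower T) ∧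
    ¬ DivisorialTower T) ∧ FourfoldTower T

/-- BY NAME: no wild occult divisorial FOURFOLD mixed tower (CELL C₄′). -/
def NoWildOccultDivisorialFourfoldMixedTowers : Prop :=
  ∀ n : ℕ, 1 ≤ n → WildOccultDivisorialFourfoldMixedWallFreeFreshJumpShallowCompanionKangarooTowersTerminate n

/-- BY NAME: no wild occult non-divisorial FOURFOLD mixed tower (CELL D₄′). -/
def NoWildOccultNonDivisorialFourfoldMixedTowers : Prop :=
  ∀ n : ℕ, 1 ≤ n → WildOccultNonDivisorialFourfoldMixedWallFreeFreshJumpShallowCompanionKangarooTowersTerminate n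

/-- BY NAME: the g43 located residual re-lettered — no wild occult FOURFOLD mixed tower (C₄′ ∧ D₄′). -/
def NoWildOccultFourfoldMixedTowers : Prop :=
  NoWildOccultDivisorialFourfoldMixedTowers ∧ NoWildOccultNonDivisorialFourfoldMixedTowers

/-- EXACT: CELL C₄ ⟺ CELL C₄′ at each weight `n ≥ 1`. [folklore] -/
theorem wildOccultDivisorialNonThreefoldMixed_iff_fourfold {n : ℕ} (hn : 1 ≤ n) :
    WildOccultDivisorialNonThreefoldMixedWallFreeFreshJumpShallowCompanionKangarooTowersTerminate n ↔
      WildOccultDivisorialFourfoldMixedWallFreeFreshJumpShallowCompanionKangarooTowersTerminate n := by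
  refine ⟨fun h p hp hpn k _ _ T g hB hD hE hP => h p hp hpn k T g hB hD hE ⟨hP.1, ?_⟩,
    fun h p hp hpn k _ _ T g hB hD hE hP => h p hp hpn k T g hB hD hE ⟨hP.1, ?_⟩⟩
  · exact (fourfoldTower_iff_not_threefold T g hB hD hn (surfaceHugging_of_mixedResidual hP.1.1.1.1)).mp hP.2
  · exact (fourfoldTower_iff_not_threefold T g hB hD hn (surfaceHugging_of_mixedResidual hP.1.1.1.1)).mpr hP.2

/-- EXACT: CELL D₄ ⟺ CELL D₄′ at each weight `n ≥ 1`. [folklore] -/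
theorem wildOccultNonDivisorialNonThreefoldMixed_iff_fourfold {n : ℕ} (hn : 1 ≤ n) :
    WildOccultNonDivisorialNonThreefoldMixedWallFreeFreshJumpShallowCompanionKangarooTowersTerminate n ↔
      WildOccultNonDivisorialFourfoldMixedWallFreeFreshJumpShallowCompanionKangarooTowersTerminate n := by
  refine ⟨fun h p hp hpn k _ _ T g hB hD hE hP => h p hp hpn k T g hB hD hE ⟨hP.1, ?_⟩,
    fun h p hp hpn k _ _ T g hB hD hE hP => h p hp hpn k T g hB hD hE ⟨hP.1, ?_⟩⟩
  · exact (fourfoldTower_iff_not_threefold T g hB hD hn (surfaceHugging_of_mixedResidual hP.1.1.1.1)).mp hP.2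
  · exact (fourfoldTower_iff_not_threefold T g hB hD hn (surfaceHugging_of_mixedResidual hP.1.1.1.1)).mpr hP.2

/-- **THE (R1) RE-LOCATION (exact, 0-weight): the g43 located residual ⟺ «no wild occult FOURFOLD mixed tower».** [folklore] -/
theorem noWildOccultNonThreefoldMixedTowers_iff_g44 : NoWildOccultNonThreefoldMixedTowers ↔ NoWildOccultFourfoldMixedTowers :=
  ⟨fun h => ⟨fun n hn => (wildOccultDivisorialNonThreefoldMixed_iff_fourfold hn).mp (h.1 n hn),
      fun n hn => (wildOccultNonDivisorialNonThreefoldMixed_iff_fourfold hn).mp (h.2 n hn)⟩,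
    fun h => ⟨fun n hn => (wildOccultDivisorialNonThreefoldMixed_iff_fourfold hn).mpr (h.1 n hn),
      fun n hn => (wildOccultNonDivisorialNonThreefoldMixed_iff_fourfold hn).mpr (h.2 n hn)⟩⟩

end DimensionCut

/-! ## §161 (g44 · ROOT) THE ROOT CONSUMERS WITH THE PORT `hC : MaxContactCut.CurveLawAll` RE-LOCATED ONTO ITS RESIDUAL
`hF : HuggedBranchResolution` — EVERY OTHER BINDER VERBATIM (g43's `noForcedTowers_of_g43`, Theorems/PolygonLawRoot :146; 14 binders,
position 2 re-typed, none added) -/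

section CurveBranchRoot

open Summit.ResolutionOfSingularities.ResolutionOfSingularities.Theses

/-- **the weight-`n` step from the g44 cells**: g43's `ftt_step_of_g43` with the port `hC : CurveLaw n` supplied from
`hF : HuggedBranchResolution` (`curveLaw_of_huggedBranchResolution`); nothing else changed. [folklore] -/
theorem ftt_step_of_g44 {n : ℕ} (hn : 1 ≤ n) (hMo : MonomialCorner n) (hF : HuggedBranchResolution) (hSL : SurfaceLaw n)
    (hH : HypersurfaceHuggingTowersTerminate n) (hP : ShadowPort n) (hM : MarkingPort n)
    (hRi : RiderPort n) (h71 : ContactHuggingTowersTerminate n)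
    (hB : WildLatentFactorNonThreefoldMixedWallFreeFreshJumpShallowCompanionKangarooTowersTerminate n)
    (hC4 : WildOccultDivisorialNonThreefoldMixedWallFreeFreshJumpShallowCompanionKangarooTowersTerminate n)
    (hD4 : WildOccultNonDivisorialNonThreefoldMixedWallFreeFreshJumpShallowCompanionKangarooTowersTerminate n)
    (hNP : ContactFreeNonPrincipalInLocusTowersTerminate n) (hPu : PurePrincipalTowersTerminate n)
    (hR : IncommensurableWildDriftingImperfectTowersTerminate n)
    (hlow : ∀ n' : ℕ, 1 ≤ n' → n' < n → ForcedTowersTerminate n') : ForcedTowersTerminate n :=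
  ftt_step_of_g43 hn hMo (curveLaw_of_huggedBranchResolution hF hn) hSL hH hP hM hRi h71 hB hC4 hD4 hNP hPu hR hlow

/-- **`∀ n ≥ 1, ForcedTowersTerminate n`**, the port `hC` re-located onto `hF`. [folklore] -/
theorem forcedTowersTerminate_of_g44 (hMo : MaxContactCut.MonomialCornerAll) (hF : HuggedBranchResolution)
    (hSL : MaxContactCut.SurfaceLawAll) (hH : MaxContactCut.NoHypersurfaceHuggingTowers) (hP : ShadowPortAll)
    (hM : MarkingPortAll) (hRi : RiderPortAll) (h71 : MaxContactCut.NoContactHuggingTowers)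
    (hB : NoWildLatentFactorNonThreefoldMixedTowers)
    (hC4 : NoWildOccultDivisorialNonThreefoldMixedTowers) (hD4 : NoWildOccultNonDivisorialNonThreefoldMixedTowers)
    (hNP : NoContactFreeNonPrincipalInLocusTowers) (hPu : NoPurePrincipalTowers) (hR : NoIncommensurableWildDriftingImperfectTowers) :
    ∀ n : ℕ, 1 ≤ n → ForcedTowersTerminate n :=
  forcedTowersTerminate_of_g43 hMo (curveLawAll_of_huggedBranchResolution hF) hSL hH hP hM hRi h71 hB hC4 hD4 hNP hPu hR

/-- **30253 `MaxContactCut.NoForcedTowers` BY NAME from the g44 cells: g43's root consumer with the structural port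
`hC : MaxContactCut.CurveLawAll` RE-LOCATED onto its located residual `hF : HuggedBranchResolution` (embedded resolution of a hugged
integral curve germ along a branch — known in print, undecided in the tree) — the other 13 binders verbatim.**  NOT a proof of
`MaxContactCut.NoForcedTowers` outright: `hMo hF hSL hP hM hRi` (structural), `hH h71` (hugging columns), `hB hC4 hD4` (non-threefold
mixed cells) and `hNP hPu hR` (leaves) remain hypotheses. [folklore] -/
theorem noForcedTowers_of_g44 (hMo : MaxContactCut.MonomialCornerAll) (hF : HuggedBranchResolution)
    (hSL : MaxContactCut.SurfaceLawAll) (hH : MaxContactCut.NoHypersurfaceHuggingTowers) (hP : ShadowPortAll)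
    (hM : MarkingPortAll) (hRi : RiderPortAll) (h71 : MaxContactCut.NoContactHuggingTowers)
    (hB : NoWildLatentFactorNonThreefoldMixedTowers)
    (hC4 : NoWildOccultDivisorialNonThreefoldMixedTowers) (hD4 : NoWildOccultNonDivisorialNonThreefoldMixedTowers)
    (hNP : NoContactFreeNonPrincipalInLocusTowers) (hPu : NoPurePrincipalTowers) (hR : NoIncommensurableWildDriftingImperfectTowers) :
    MaxContactCut.NoForcedTowers :=
  noForcedTowers_of_g43 hMo (curveLawAll_of_huggedBranchResolution hF) hSL hH hP hM hRi h71 hB hC4 hD4 hNP hPu hR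

/-- the same from the ABSOLUTE g43 located residual `NoWildOccultNonThreefoldMixedTowers` by name (13 binders). [folklore] -/
theorem noForcedTowers_of_g44_residual (hMo : MaxContactCut.MonomialCornerAll) (hF : HuggedBranchResolution)
    (hSL : MaxContactCut.SurfaceLawAll) (hH : MaxContactCut.NoHypersurfaceHuggingTowers) (hP : ShadowPortAll)
    (hM : MarkingPortAll) (hRi : RiderPortAll) (h71 : MaxContactCut.NoContactHuggingTowers)
    (hB : NoWildLatentFactorNonThreefoldMixedTowers) (hres : NoWildOccultNonThreefoldMixedTowers)
    (hNP : NoContactFreeNonPrincipalInLocusTowers) (hPu : NoPurePrincipalTowers) (hR : NoIncommensurableWildDriftingImperfectTowers) :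
    MaxContactCut.NoForcedTowers :=
  noForcedTowers_of_g44 hMo hF hSL hH hP hM hRi h71 hB hres.1 hres.2 hNP hPu hR

/-- **the original root is RECOVERED from the new one's cells plus the exact carve** (no strength lost: `hC` ⟺ the residual cell law,
and F ⟹ it). [folklore] -/
theorem noForcedTowers_of_g44_carve (hMo : MaxContactCut.MonomialCornerAll) (hS : SingularBranchCurveLawAll)
    (hSL : MaxContactCut.SurfaceLawAll) (hH : MaxContactCut.NoHypersurfaceHuggingTowers) (hP : ShadowPortAll)
    (hM : MarkingPortAll) (hRi : RiderPortAll) (h71 : MaxContactCut.NoContactHuggingTowers)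
    (hB : NoWildLatentFactorNonThreefoldMixedTowers)
    (hC4 : NoWildOccultDivisorialNonThreefoldMixedTowers) (hD4 : NoWildOccultNonDivisorialNonThreefoldMixedTowers)
    (hNP : NoContactFreeNonPrincipalInLocusTowers) (hPu : NoPurePrincipalTowers) (hR : NoIncommensurableWildDriftingImperfectTowers) :
    MaxContactCut.NoForcedTowers :=
  noForcedTowers_of_g43 hMo (curveLawAll_iff_g44.mpr hS) hSL hH hP hM hRi h71 hB hC4 hD4 hNP hPu hR

end CurveBranchRoot

end Summit.ResolutionOfSingularities.ResolutionOfSingularities.Theorems.HugValuationCut
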